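import Literature.AlgebraicGeometry.CossartPiltant200819.GaloisTower2008
import Mathlib.RingTheory.Valuation.RankOne
import Mathlib.FieldTheory.PurelyInseparable.PerfectClosure
import HarnessLib

/-!
# Cossart–Piltant 2008, Thm 7.2: inheritance along the tower (clauses T-e, T-f)

Sequel of `GaloisTower2008.lean`. Its named fact `GaloisTowerExists2008 k` still asks, at every
move of the tower of the proof of [CossartPiltant2008] Thm 7.2 (HAL pp. 20–21), for bookkeeping
hypotheses the printed proof never mentions because they are inherited along finite extensions
and restrictions of valued function fields: finite generation and `trdeg 3` of the current
field, rank one and residual algebraicity of the current valuation ring (clause **T-e** of the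
cell's audit), and — at each purely inseparable degree-`p` step — uniqueness of the extension of
the valuation ring (clause **T-f**, purely inseparable half). This file PROVES the lemmas that
discharge them (all [folklore]); `BareTower2008.lean` removes the hypotheses from the named fact.

* `nonempty_rankOne_iff_archimedean` — a valuation of a field has rank one (Mathlib's
  `Valuation.RankOne`: an embedding of the value group into `ℝ≥0`) iff some value exceeds `1`
  and the values are archimedean (`Valuation.nonempty_rankOne_iff_mulArchimedean`, elementwise);
* `nonempty_rankOne_comap_of_isAlgebraic`, `nonempty_rankOne_of_comap_of_isAlgebraic` — rank one
  passes down and up an algebraic extension `L/K` (a power of every `z ∈ L^×` has the value of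
  an element of `K`, `exists_valuation_pow_eq_of_isAlgebraic`);
* `residueTrdeg_comap_eq_zero`, `residueTrdeg_eq_zero_of_comap` — residual algebraicity over `k`
  passes down an algebraic and up a finite extension (the residue extension of a finite extension
  is finite, `ramificationIndex_mul_inertiaDegree_le_finrank`);
* `trdeg_eq_of_isAlgebraic'`, `fg_top_of_fg_top_of_finite` — `trdeg_k` is unchanged in an
  algebraic extension; a subfield `K` of finite codimension of a finitely generated `K₁/k` is
  finitely generated (transcendence basis `t` of `K/k`, `K₁/k(t)` finite, `K/k(t)` finite);
  upwards this is `intermediateField_fg_top_of_finite` (`AbhyankarBases.lean`);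
* `eq_of_comap_eq_of_forall_pow_mem`, `eq_of_comap_eq_of_isPurelyInseparable`,
  `isPurelyInseparable_of_pthRoot` — a valuation ring of `K` extends uniquely to a radicial
  (e.g. purely inseparable) extension `L` (`z ∈ W ↔ z^n ∈ W ∩ K`): the uniqueness clause of the
  purely inseparable steps `K₁,ᵢ ⊂ K₁,ᵢ₊₁ = K₁,ᵢ(ηᵢ₊₁)`, `η^p ∈ K₁,ᵢ` (HAL p. 20 l. 17–28);
* `eq_of_comap_eq_of_forall_smul_eq`, `comap_eq_of_forall_smul_eq` — in a finite Galois
  extension `E/F`, a valuation ring `W` fixed by `Gal(E/F)` (i.e. `F` contains the decomposition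
  field of `W`) is the only extension of `W ∩ F`, and its trace `W ∩ M` the only extension of
  `W ∩ F` to an intermediate field `M` (conjugation theorem `exists_smul_eq_of_comap_eq` +
  Chevalley `exists_valuationSubring_comap_eq`): the uniqueness clause of the Galois degree-`p`
  steps of `K₀ʳ ⊆ Kʳ`, which lie above the decomposition field (HAL p. 21 l. 3–28), clause
  **T-f**, Galois half.

References: V. Cossart, O. Piltant, *Resolution of singularities of threefolds in positive
characteristic. I*, J. Algebra 320 (2008) 1051–1082 = HAL hal-00139124, proof of Thm 7.2,
pp. 20–21 [CossartPiltant2008]; O. Zariski, P. Samuel, *Commutative Algebra II*, VI §§7, 12;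
O. Endler, *Valuation Theory*, §14 [folklore].
-/

namespace Literature.AlgebraicGeometry.CossartPiltant200819.CP2008

open Literature.AlgebraicGeometry.Resolution IsLocalRing
open scoped Pointwise

universe u

/-! ### Rank one, elementwise -/

section RankOne

variable {K : Type u} [Field K] {Γ₀ : Type*} [LinearOrderedCommGroupWithZero Γ₀]

/-- **Rank one = non-trivial + archimedean**: a valuation `v` of a field admits a rank-one
structure (an order embedding of its value group into `ℝ≥0`, Mathlib `Valuation.RankOne`) iff
some element has value `> 1` and for all `a, b` with `1 < v a` some power `v a ^ n` exceeds `v b`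
(Hölder; Mathlib's `Valuation.nonempty_rankOne_iff_mulArchimedean` made elementwise through
`Valuation.restrict`). [folklore] -/
theorem nonempty_rankOne_iff_archimedean (v : Valuation K Γ₀) :
    Nonempty v.RankOne ↔ (∃ a, 1 < v a) ∧ ∀ a b, 1 < v a → ∃ n : ℕ, v b ≤ v a ^ n := by
  constructor
  · rintro ⟨hr⟩
    haveI : v.IsNontrivial := hr.toIsNontrivial
    have hM : MulArchimedean (MonoidWithZeroHom.ValueGroup₀ (MonoidWithZeroHom.ofClass v)) :=
      Valuation.nonempty_rankOne_iff_mulArchimedean.mp ⟨hr⟩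
    refine ⟨?_, fun a b ha => ?_⟩
    · obtain ⟨x, hx0, hx1⟩ := hr.toIsNontrivial.exists_val_nontrivial
      rcases lt_or_gt_of_ne hx1 with hlt | hgt
      · refine ⟨x⁻¹, ?_⟩
        rw [map_inv₀]
        exact (one_lt_inv₀ (zero_lt_iff.mpr hx0)).mpr hlt
      · exact ⟨x, hgt⟩
    · have ha' : v.restrict 1 < v.restrict a := v.restrict_lt_iff.mpr (by rwa [map_one])
      rw [map_one] at ha'
      obtain ⟨n, hn⟩ := MulArchimedean.arch (v.restrict b) ha'
      refine ⟨n, ?_⟩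
      rw [← map_pow] at hn ⊢
      exact v.restrict_le_iff.mp hn
  · rintro ⟨⟨a, ha⟩, harch⟩
    haveI : v.IsNontrivial := ⟨a, (zero_lt_one.trans ha).ne', ne_of_gt ha⟩
    refine Valuation.nonempty_rankOne_iff_mulArchimedean.mpr ⟨fun x y hy => ?_⟩
    obtain ⟨b, rfl⟩ :=
      MonoidWithZeroHom.ValueGroup₀.restrict₀_surjective (MonoidWithZeroHom.ofClass v) x
    obtain ⟨c, rfl⟩ :=
      MonoidWithZeroHom.ValueGroup₀.restrict₀_surjective (MonoidWithZeroHom.ofClass v) y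
    have hy' : 1 < v.restrict c := hy
    show ∃ n : ℕ, v.restrict b ≤ v.restrict c ^ n
    have hc : 1 < v c := by
      have h := v.restrict_lt_iff (x := 1) (y := c)
      rw [map_one, map_one] at h
      exact h.mp hy'
    obtain ⟨n, hn⟩ := harch c b hc
    refine ⟨n, ?_⟩
    rw [← map_pow, v.restrict_le_iff, map_pow]
    exact hn

end RankOne

/-! ### Rank one and residual algebraicity up and down an algebraic extension -/

section Extension

variable {K L : Type u} [Field K] [Field L] [Algebra K L]

/-- `1 < (A ∩ F)(y)` iff `1 < A(f y)` (`comap_valuation_lt_iff` with `1`). [folklore] -/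
theorem one_lt_comap_valuation_iff {F Ω : Type*} [Field F] [Field Ω] (A : ValuationSubring Ω)
    (f : F →+* Ω) (y : F) : 1 < (A.comap f).valuation y ↔ 1 < A.valuation (f y) := by
  have h := comap_valuation_lt_iff A f 1 y
  rwa [map_one, map_one, map_one] at h

/-- Restriction of valuation rings along a tower `K → M → L`: `(W ∩ M) ∩ K = W ∩ K`. [folklore] -/
theorem comap_comap_algebraMap (M : Type u) [Field M] [Algebra K M] [Algebra M L]
    [IsScalarTower K M L] (W : ValuationSubring L) :
    (W.comap (algebraMap M L)).comap (algebraMap K M) = W.comap (algebraMap K L) := by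
  rw [ValuationSubring.comap_comap, ← IsScalarTower.algebraMap_eq]

variable (K) in
/-- **Values of an algebraic extension are torsion over the values of the base**: for `L/K`
algebraic, `W` a valuation ring of `L` and `z ∈ L^×`, some `z^n` (`n ≥ 1`) has the value of an
element of `K` (`exists_valuation_pow_eq_of_isAlgebraic`, two summands of a relation have equal
value). [folklore] -/
theorem exists_pow_valuation_eq_algebraMap [Algebra.IsAlgebraic K L] (W : ValuationSubring L)
    {z : L} (hz : z ≠ 0) :
    ∃ n : ℕ, n ≠ 0 ∧ ∃ c : K, W.valuation (z ^ n) = W.valuation (algebraMap K L c) := by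
  have hz' : IsAlgebraic (algebraMap K L).fieldRange z :=
    (Algebra.IsAlgebraic.isAlgebraic (R := K) z).ringHom_of_comp_eq
      (algebraMap K L).rangeRestrictField (RingHom.id L)
      (algebraMap K L).rangeRestrictField_bijective.1 (by ext; rfl)
  obtain ⟨n, hn, b, hb, h⟩ := exists_valuation_pow_eq_of_isAlgebraic W hz' hz
  obtain ⟨c, rfl⟩ := RingHom.mem_fieldRange.mp hb
  exact ⟨n, hn, c, h⟩

/-- **Rank one passes down an algebraic extension**: if `W` on `L ⊇ K` (algebraic) has rank one,
so has `W ∩ K` (non-trivial on `K` because a power of an element of value `> 1` has the value of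
an element of `K`; archimedean by restriction). [folklore] -/
theorem nonempty_rankOne_comap_of_isAlgebraic [Algebra.IsAlgebraic K L] (W : ValuationSubring L)
    (h1 : Nonempty W.valuation.RankOne) :
    Nonempty (W.comap (algebraMap K L)).valuation.RankOne := by
  obtain ⟨⟨a, ha⟩, harch⟩ := (nonempty_rankOne_iff_archimedean W.valuation).mp h1
  refine (nonempty_rankOne_iff_archimedean _).mpr ⟨?_, fun c d hc => ?_⟩
  · have ha0 : a ≠ 0 := by rintro rfl; rw [map_zero] at ha; exact (not_lt.mpr zero_le_one) ha
    obtain ⟨n, hn, c, hc⟩ := exists_pow_valuation_eq_algebraMap K W ha0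
    refine ⟨c, (one_lt_comap_valuation_iff W _ c).mpr ?_⟩
    rw [← hc, map_pow]
    exact one_lt_pow₀ ha hn
  · rw [one_lt_comap_valuation_iff] at hc
    obtain ⟨n, hn⟩ := harch _ (algebraMap K L d) hc
    refine ⟨n, ?_⟩
    rw [← map_pow, comap_valuation_le_iff, map_pow, map_pow]
    exact hn

/-- **Rank one passes up an algebraic extension**: if `W ∩ K` has rank one and `L/K` is
algebraic, `W` has rank one (for `1 < W(a)`, `1 < W(b)`: `a^n ~ c₁ ∈ K`, `b^m ~ d₁ ∈ K`,
`W(d₁) ≤ W(c₁)^N`, so `W(b) ≤ W(b)^m ≤ W(a)^{nN}`). [folklore] -/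
theorem nonempty_rankOne_of_comap_of_isAlgebraic [Algebra.IsAlgebraic K L]
    (W : ValuationSubring L) (h1 : Nonempty (W.comap (algebraMap K L)).valuation.RankOne) :
    Nonempty W.valuation.RankOne := by
  obtain ⟨⟨c, hc⟩, harch⟩ := (nonempty_rankOne_iff_archimedean _).mp h1
  rw [one_lt_comap_valuation_iff] at hc
  refine (nonempty_rankOne_iff_archimedean _).mpr ⟨⟨algebraMap K L c, hc⟩, fun a b ha => ?_⟩
  by_cases hb : W.valuation b ≤ 1
  · exact ⟨0, by rw [pow_zero]; exact hb⟩
  rw [not_le] at hb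
  have ha0 : a ≠ 0 := by rintro rfl; rw [map_zero] at ha; exact (not_lt.mpr zero_le_one) ha
  have hb0 : b ≠ 0 := by rintro rfl; rw [map_zero] at hb; exact (not_lt.mpr zero_le_one) hb
  obtain ⟨n, hn, c₁, hc₁⟩ := exists_pow_valuation_eq_algebraMap K W ha0
  obtain ⟨m, hm, d₁, hd₁⟩ := exists_pow_valuation_eq_algebraMap K W hb0
  have hc₁' : 1 < (W.comap (algebraMap K L)).valuation c₁ := by
    rw [one_lt_comap_valuation_iff, ← hc₁, map_pow]
    exact one_lt_pow₀ ha hn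
  obtain ⟨N, hN⟩ := harch c₁ d₁ hc₁'
  rw [← map_pow, comap_valuation_le_iff, map_pow, map_pow, ← hc₁, ← hd₁, map_pow, map_pow,
    ← pow_mul] at hN
  exact ⟨n * N, le_trans (le_self_pow₀ hb.le hm) hN⟩

variable {k : Type u} [Field k] [Algebra k K] [Algebra k L] [IsScalarTower k K L]

/-- `residueTrdeg` does not depend on the proof of `k ⊆ O`, nor on the name of `O`. [folklore] -/
theorem residueTrdeg_congr {F : Type u} [Field F] [Algebra k F] {O O' : ValuationSubring F}
    (h : O = O') (hk : ∀ c : k, algebraMap k F c ∈ O) (hk' : ∀ c : k, algebraMap k F c ∈ O') :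
    residueTrdeg k O hk = residueTrdeg k O' hk' := by
  subst h
  rfl

/-- `F = 0` iff the residue field is algebraic over `k` (`Algebra.trdeg_eq_zero_iff`). [folklore] -/
theorem residueTrdeg_eq_zero_iff {F : Type u} [Field F] [Algebra k F] (O : ValuationSubring F)
    (hk : ∀ c : k, algebraMap k F c ∈ O) :
    residueTrdeg k O hk = 0 ↔
      letI := algebraOfMem k O hk
      Algebra.IsAlgebraic k (ResidueField O) := by
  letI := algebraOfMem k O hk
  unfold residueTrdeg
  exact trdeg_eq_zero_iff

/-- `k → O → κ(O)` is `c ↦ residue ⟨c, _⟩`. [folklore] -/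
theorem algebraMap_residueField_apply {F : Type u} [Field F] [Algebra k F] (O : ValuationSubring F)
    (hk : ∀ c : k, algebraMap k F c ∈ O) (c : k) :
    letI := algebraOfMem k O hk
    algebraMap k (ResidueField O) c = residue O ⟨algebraMap k F c, hk c⟩ := by
  letI := algebraOfMem k O hk
  rw [IsScalarTower.algebraMap_apply k O (ResidueField O), ResidueField.algebraMap_eq]
  rfl

/-- **Residual algebraicity passes down**: `F(W ∩ K) ≤ F(W) = 0` (`residueTrdeg_comap_le`).
[folklore] -/
theorem residueTrdeg_comap_eq_zero (W : ValuationSubring L) (hkW : ∀ c : k, algebraMap k L c ∈ W)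
    (h0 : residueTrdeg k W hkW = 0) :
    residueTrdeg k (W.comap (algebraMap K L)) (forall_algebraMap_mem_comap (K := K) hkW) = 0 := by
  have h := residueTrdeg_comap_le k W hkW (forall_algebraMap_mem_comap (K := K) hkW)
  rw [h0] at h
  exact nonpos_iff_eq_zero.mp h

/-- **Residual algebraicity passes up a finite extension**: if `L/K` is finite and the residue
field of `W ∩ K` is algebraic over `k`, so is that of `W` — it is finite over the subfield
`K̃ ⊆ L̃` of residues of `K ∩ W` (`ramificationIndex_mul_inertiaDegree_le_finrank`), which is
the image of the residue field of `W ∩ K` (`fieldRange_residueFieldHom`). [folklore] -/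
theorem residueTrdeg_eq_zero_of_comap [FiniteDimensional K L] (W : ValuationSubring L)
    (hkW : ∀ c : k, algebraMap k L c ∈ W)
    (h0 : residueTrdeg k (W.comap (algebraMap K L)) (forall_algebraMap_mem_comap hkW) = 0) :
    residueTrdeg k W hkW = 0 := by
  set O := W.comap (algebraMap K L) with hO
  have hkO : ∀ c : k, algebraMap k K c ∈ O := forall_algebraMap_mem_comap hkW
  letI := algebraOfMem k W hkW
  letI := algebraOfMem k O hkO
  have halgO : Algebra.IsAlgebraic k (ResidueField O) := (residueTrdeg_eq_zero_iff O hkO).mp h0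
  rw [residueTrdeg_eq_zero_iff]
  -- `k → K̃ → L̃`
  set φ := residueFieldHom K W with hφ
  have hcompat : ∀ c : k,
      algebraMap k (ResidueField W) c = φ (algebraMap k (ResidueField O) c) := by
    intro c
    rw [algebraMap_residueField_apply W hkW c, algebraMap_residueField_apply O hkO c, hφ,
      residueFieldHom_residue]
    congr 1
    apply Subtype.ext
    rw [coe_comapSubringHom_apply]
    exact IsScalarTower.algebraMap_apply k K L c
  set R : Subfield (ResidueField W) := φ.fieldRange with hR
  have hmem : ∀ c : k, algebraMap k (ResidueField W) c ∈ R := fun c => by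
    rw [hcompat c]
    exact RingHom.mem_fieldRange.mpr ⟨_, rfl⟩
  letI : Algebra k R := ((algebraMap k (ResidueField W)).codRestrict R hmem).toAlgebra
  haveI : IsScalarTower k R (ResidueField W) := IsScalarTower.of_algebraMap_eq fun _ => rfl
  -- `K̃` is algebraic over `k`: it is the image of the residue field of `W ∩ K`
  haveI : Algebra.IsAlgebraic k R :=
    Algebra.IsAlgebraic.ringHom_of_comp_eq (RingHom.id k) φ.rangeRestrictField
      Function.injective_id φ.rangeRestrictField_bijective.2
      (RingHom.ext fun c => Subtype.ext (hcompat c))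
  -- `L̃` is finite over `K̃`
  obtain ⟨-, hfin, -⟩ := ramificationIndex_mul_inertiaDegree_le_finrank K W
  rw [← fieldRange_residueFieldHom] at hfin
  haveI : Module.Finite R (ResidueField W) := hfin
  haveI : Algebra.IsAlgebraic R (ResidueField W) := Algebra.IsAlgebraic.of_finite R _
  exact Algebra.IsAlgebraic.trans k R (ResidueField W)

/-! ### Finite generation and transcendence degree -/

/-- **`trdeg_k` is unchanged in an algebraic extension** (`trdeg_add_eq`, `trdeg_eq_zero`).
[folklore] -/
theorem trdeg_eq_of_isAlgebraic' [Algebra.IsAlgebraic K L] :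
    Algebra.trdeg k L = Algebra.trdeg k K := by
  have h := trdeg_add_eq k K (A := L)
  rw [trdeg_eq_zero (R := K) (A := L), add_zero] at h
  exact h.symm

/-- **A subfield of finite codimension of a finitely generated extension is finitely
generated**: `K ⊆ K₁`, `K₁/K` finite, `K₁/k` finitely generated `⇒` `K/k` finitely generated
(choose a transcendence basis `t` of `K/k` — finite, `trdeg_k K = trdeg_k K₁ < ℵ₀`; `K₁` is
algebraic and finitely generated, hence finite, over `k(t)`; so is its `k(t)`-subspace `K`).
[folklore] -/
theorem fg_top_of_fg_top_of_finite [FiniteDimensional K L]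
    (hfg : (⊤ : IntermediateField k L).FG) : (⊤ : IntermediateField k K).FG := by
  classical
  -- a finite transcendence basis of `K/k`
  have hN : Algebra.trdeg k K < Cardinal.aleph0 := by
    rw [← trdeg_eq_of_isAlgebraic' (K := K) (L := L)]
    exact trdeg_lt_aleph0_of_fg hfg
  obtain ⟨s, hs⟩ := exists_isTranscendenceBasis k K
  have hsfin : s.Finite := by
    rw [← Cardinal.lt_aleph0_iff_set_finite, hs.cardinalMk_eq_trdeg]
    exact hN
  haveI : Finite s := hsfin.to_subtype
  set k₀ : IntermediateField k K := IntermediateField.adjoin k (Set.range ((↑) : s → K)) with hk₀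
  haveI halgK : Algebra.IsAlgebraic k₀ K := hs.isAlgebraic_field
  -- `K₁` over `k(t)` (`k(t) ⊆ K` acts on `L` through `K`)
  haveI : Algebra.IsAlgebraic k₀ L := Algebra.IsAlgebraic.trans k₀ K L
  haveI : Algebra.EssFiniteType k L := IntermediateField.fg_top_iff.mp hfg
  haveI : Algebra.EssFiniteType k₀ L := Algebra.EssFiniteType.of_comp k k₀ L
  obtain ⟨T, hT⟩ := IntermediateField.fg_top k₀ L
  haveI : FiniteDimensional k₀ L := by
    have hfin : FiniteDimensional k₀ (IntermediateField.adjoin k₀ (T : Set L)) :=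
      IntermediateField.finiteDimensional_adjoin fun x _ =>
        (Algebra.IsAlgebraic.isAlgebraic x).isIntegral
    rw [hT] at hfin
    exact Module.Finite.of_surjective (IntermediateField.topEquiv (F := k₀) (E := L)).toLinearMap
      IntermediateField.topEquiv.surjective
  -- `K/k(t)` finite, hence finitely generated; `k(t)/k` finitely generated
  haveI : FiniteDimensional k₀ K :=
    FiniteDimensional.of_injective (IsScalarTower.toAlgHom k₀ K L).toLinearMap
      (algebraMap K L).injective
  haveI : Algebra.EssFiniteType k₀ K :=
    IntermediateField.fg_top_iff.mp (IntermediateField.fg_of_noetherian ⊤)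
  haveI : Algebra.EssFiniteType k k₀ :=
    IntermediateField.essFiniteType_iff.mpr
      (IntermediateField.fg_adjoin_of_finite (Set.finite_range _))
  haveI : Algebra.EssFiniteType k K := Algebra.EssFiniteType.comp k k₀ K
  exact IntermediateField.fg_top_iff.mpr inferInstance

end Extension

/-! ### Uniqueness of the extension of a valuation ring (clause T-f) -/

section Unique

variable {K L : Type u} [Field K] [Field L] [Algebra K L]

/-- **Radicial extensions extend valuation rings uniquely**: if every `z ∈ L` has a power
`z^n ∈ K` (`n ≥ 1`), two valuation rings of `L` with the same trace on `K` coincide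
(`z ∈ W ↔ z^n ∈ W ↔ z^n ∈ W ∩ K`). [folklore] -/
theorem eq_of_comap_eq_of_forall_pow_mem
    (hpow : ∀ z : L, ∃ n : ℕ, n ≠ 0 ∧ z ^ n ∈ (algebraMap K L).range)
    {W W' : _root_.ValuationSubring L}
    (h : W'.comap (algebraMap K L) = W.comap (algebraMap K L)) : W' = W := by
  have key : ∀ (P : _root_.ValuationSubring L) (z : L) (n : ℕ), n ≠ 0 → (z ∈ P ↔ z ^ n ∈ P) := by
    intro P z n hn
    refine ⟨fun hz => pow_mem hz n, fun hz => ?_⟩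
    rw [← P.valuation_le_one_iff] at hz ⊢
    rw [map_pow] at hz
    by_contra hlt
    exact (not_lt.mpr hz) (one_lt_pow₀ (not_le.mp hlt) hn)
  ext z
  obtain ⟨n, hn, hzn⟩ := hpow z
  obtain ⟨c, hc⟩ := RingHom.mem_range.mp hzn
  rw [key W' z n hn, key W z n hn, ← hc]
  change c ∈ W'.comap (algebraMap K L) ↔ c ∈ W.comap (algebraMap K L)
  rw [h]

/-- **A purely inseparable extension extends valuation rings uniquely**
(`isPurelyInseparable_iff_pow_mem`: `z^{q^n} ∈ K`). [folklore] -/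
theorem eq_of_comap_eq_of_isPurelyInseparable [IsPurelyInseparable K L]
    {W W' : _root_.ValuationSubring L}
    (h : W'.comap (algebraMap K L) = W.comap (algebraMap K L)) : W' = W := by
  obtain ⟨q, hq⟩ := ExpChar.exists K
  refine eq_of_comap_eq_of_forall_pow_mem (fun z => ?_) h
  obtain ⟨n, hn⟩ := (isPurelyInseparable_iff_pow_mem K q).mp ‹_› z
  exact ⟨q ^ n, pow_ne_zero n (expChar_pos K q).ne', hn⟩

open IntermediateField in
/-- **`K(η)/K` with `η^p ∈ K` is purely inseparable** (`p = char K`). [folklore] -/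
theorem isPurelyInseparable_of_pthRoot {p : ℕ} [hp : Fact p.Prime] [CharP K p] {η : L} {b₀ : K}
    (hη : η ^ p = algebraMap K L b₀) (hηtop : K⟮η⟯ = ⊤) : IsPurelyInseparable K L := by
  haveI : ExpChar K p := ExpChar.prime hp.out
  have h1 : IsPurelyInseparable K K⟮η⟯ :=
    (IntermediateField.isPurelyInseparable_adjoin_simple_iff_pow_mem K L p).mpr
      ⟨1, b₀, by rw [pow_one, hη]⟩
  rw [hηtop] at h1
  exact (IntermediateField.topEquiv (F := K) (E := L)).isPurelyInseparable

/-- **Above the decomposition field the extension is unique**: in a finite Galois extension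
`E/F`, a valuation ring `W` of `E` fixed by every `σ ∈ Gal(E/F)` is the only valuation ring over
`W ∩ F` (the extensions are the conjugates `σ • W`, `exists_smul_eq_of_comap_eq`). [folklore] -/
theorem eq_of_comap_eq_of_forall_smul_eq {F E : Type u} [Field F] [Field E]
    [Algebra F E] [FiniteDimensional F E] [IsGalois F E] (W : _root_.ValuationSubring E)
    (hW : ∀ σ : E ≃ₐ[F] E, σ • W = W) {W' : _root_.ValuationSubring E}
    (h : W'.comap (algebraMap F E) = W.comap (algebraMap F E)) : W' = W := by
  obtain ⟨σ, hσ⟩ := ValuationSubring.exists_smul_eq_of_comap_eq W W' h.symm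
  rw [← hσ, hW σ]

/-- **… and so is its trace on every intermediate field**: with `W` as above and
`F ⊆ M ⊆ E`, the only valuation ring of `M` over `W ∩ F` is `W ∩ M` (extend a competitor to `E`
by Chevalley, `exists_valuationSubring_comap_eq`, and compare there). This is the uniqueness
hypothesis of the moves `galoisP` between consecutive fields of the tower `K₀ʳ ⊆ … ⊆ Kʳ` above
the decomposition field. [folklore] -/
theorem comap_eq_of_forall_smul_eq {F E : Type u} [Field F] [Field E]
    [Algebra F E] [FiniteDimensional F E] [IsGalois F E] (W : _root_.ValuationSubring E)
    (hW : ∀ σ : E ≃ₐ[F] E, σ • W = W) (M : IntermediateField F E)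
    {W' : _root_.ValuationSubring M} (h : W'.comap (algebraMap F M) = W.comap (algebraMap F E)) :
    W' = W.comap (algebraMap M E) := by
  obtain ⟨P, hP⟩ := exists_valuationSubring_comap_eq (Ω := E) W'
  have hPF : P.comap (algebraMap F E) = W.comap (algebraMap F E) := by
    rw [← comap_comap_algebraMap M P, hP, h]
  rw [← hP, eq_of_comap_eq_of_forall_smul_eq W hW hPF]

end Unique

end Literature.AlgebraicGeometry.CossartPiltant200819.CP2008
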